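import Summits.NavierStokesRegularity.NavierStokesRegularity.Theorems.RellichScarDefs
import Summits.NavierStokesRegularity.NavierStokesRegularity.Theorems.RellichScarScarRigidityApexRegularityKernel
import Summits.NavierStokesRegularity.NavierStokesRegularity.Theorems.RellichScarScarRigidityApexRegularityExchange
import Summits.NavierStokesRegularity.NavierStokesRegularity.Theorems.RellichScarScarRigidityApexBounds
import Summits.NavierStokesRegularity.NavierStokesRegularity.Theorems.RellichScarSymmetricScarExistsTypeITimeDerivDecay
import Literature.Analysis.FluidPDE.TypeIAncientMild
import HarnessLib

/-!
# Crux `ScarRigidity` (stmt-NavierStokesRegularity-11717), line `moment-conditioned-rellich`: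
# stub `stub_apexRegularity` (S-reg) — the Riesz pressure at ALL orders and the assembly

Theorems only (`--supports stmt-NavierStokesRegularity-11717`; no definitions, no named facts).  The registered
stub `stub_apexRegularity`: a Type-I ancient mild field `V` with the apex bound `‖V(t,x)‖ ≤ C/(‖x‖+√(−t))` is a
classical Navier–Stokes solution on `(−∞,0) × ℝ³` for a classical pressure `Q` with the ALL-ORDERS package
`ScaleInvariantBounds V Q` (`‖∇ⁿV‖ ≤ L/(‖x‖+√(−t))^{1+n}`, `‖∇ⁿQ‖ ≤ L/(‖x‖+√(−t))^{2+n}`,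
`‖∂ₜ∇ⁿV‖ ≤ L/(‖x‖+√(−t))^{3+n}`).  `Q` is the Riesz pressure `Q[V(t)] = RᵢRⱼ(VᵢVⱼ)`, the tree's
`pressurePotential (V t) = −Q₁[V(t)] − Q₂[V(t)]` (near part against the truncated Newtonian kernel `Γ₀^{1,2} ∈ L¹`,
far part against the smooth far kernel `Φ = D²Γ∞^{1,2}`).

1. `stub_apexRegPressureBounds` (registered sub-goal): `(‖x‖+√(−t))^{n+2}‖DⁿQ[v(t)](x)‖ ≤ K(n, C)` for EVERY `n`,
   generalising the sibling crux's `apexRieszPressure_scaleInvariantBounds` (`n ≤ 2`) along the same steps — near part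
   `‖DⁿQ₁[w](x)‖ ≤ N₁ sup_{B(x,2)}‖DⁿG[w]‖` (all derivatives under the integral sign), far part
   `‖DⁿQ₂[v](x)‖ ≤ M_n K_far C₀²` at `‖x‖ ≤ 16` (`DⁿQ₂[v](x) m = ∫ DⁿΦ(x − y) m (v y, v y) dy`, kernel decay
   `stub_apexRegKernelDecay`, dominator `exists_dominator_far`), the unit scale `max{‖y‖, √(−s)} = 16` (all of `B(y,2)`
   has parabolic size `≥ 1`, so `‖Dʲw(s)‖ ≤ K_j(C)`, `j ≤ n + 2`), and the rescaling by `λ = max{‖x‖, √(−t)}/16`.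
2. `isSmoothSpaceTimeOn_rieszPressure`: `(t,x) ↦ Q[V(t)](x)` is jointly `C^∞` — the sibling crux reduced this to the
   decay at spatial infinity of the iterated time derivatives of `V` on compact windows
   (`isSmoothSpaceTimeOn_pressurePotential_of_far`, `contDiffOn_farPotential_zero_of_decay`), which is its landed
   `stub_typeITimeDerivDecay` (KNSS 2009 Prop. 4.1 + Thm. 6.1, Landau–Kolmogorov in time); hence `(V, Q[V])` is
   classical (`isClassicalNSSolutionOn_rieszPressure`, `∇q = ∇Q[V]` by `gradient_pressure_eq_of_typeI_vertex`).
3. `scaleInvariantBounds_rieszPressure`: velocity at all orders (`exists_weight_pow_mul_norm_iteratedFDeriv_le`),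
   pressure at all orders (1.), `∂ₜDⁿV` from the differentiated momentum equation (`stub_apexRegTimeDerivative`);
   `stub_apexRegularity` takes the classical pressure of `exists_isClassicalNSSolutionOn_Iio` and re-gauges to `Q[V]`.

## References

* G. Koch, N. Nadirashvili, G. Seregin, V. Šverák, Acta Math. 203 (2009) = arXiv:0709.3599, Prop. 4.1, Thm. 6.1.
  [KochNadirashviliSereginSverak2009]
* G. Seregin, V. Šverák, Comm. PDE 34 (2009) = arXiv:0804.1803, §2 p. 8. [SereginSverak2009]
* B. Pineau, V. Vicol, arXiv:2607.09619 (2026), Lemma 2.1, Lemma 7.1. [PineauVicol2026]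
* D. Gilbarg, N. S. Trudinger, *Elliptic PDE of Second Order* (2001), Lemma 4.1–4.2. [GilbargTrudinger2001]
-/

noncomputable section

open MeasureTheory Set Function Filter Topology Metric
open scoped ContDiff

-- nested operator types (`ℝ³ →L[ℝ] ℝ³ →L[ℝ] ℝ³ →L[ℝ] ℝ` inside `ℝ³ [×n]→L[ℝ] _`)
set_option maxSynthPendingDepth 4

set_option linter.dupNamespace false -- D-0017: `Summit.<S>.<S>.…` repeats the summit name by design

namespace Summit.NavierStokesRegularity.NavierStokesRegularity.Theorems.RellichScarScarRigidity

open Literature.Analysis.FluidPDE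
open Literature.Analysis.FluidPDE.FourierNS (HasDecay)
open Literature.Analysis.FluidPDE.PineauVicol2026 (newtonNearMass newtonNearMass_nonneg)
open Summit.NavierStokesRegularity.NavierStokesRegularity.Theorems.SymmetricScarExists.LogtimeBernoulli
  (norm_iteratedFDeriv_pressureSource_le exists_dominator_far farConst_nonneg norm_integral_le_of_dominator
    one_le_max_of_normalised pressurePotential_zoom)

/-- Physical space. -/
local notation "ℝ³" => EuclideanSpace ℝ (Fin 3)

/-! ### The near potential at all orders -/

/-- **All derivatives of the near potential through the source**: for a smooth field `w`, if `‖DⁿG[w]‖ ≤ S` on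
`B(x, 2)` (`G[w] = ∂ᵢ∂ⱼ(wᵢwⱼ)`), then `‖DⁿQ₁[w](x)‖ ≤ N₁ S` for `Q₁[w](x) = ∫ Γ₀(z) G[w](x − z) dz` (`N₁ = ∫|Γ₀^{1,2}|`;
all derivatives under the integral sign against the compactly supported `L¹` kernel,
`iteratedFDeriv_integral_smul_comp_sub_apply`). [cite: GilbargTrudinger2001, Lemma 4.1] -/
theorem norm_iteratedFDeriv_nearPotential_le {w : ℝ³ → ℝ³} (hw : ContDiff ℝ ∞ w) (n : ℕ) (x : ℝ³) {S : ℝ}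
    (hS : ∀ z : ℝ³, ‖z‖ ≤ 2 → ‖iteratedFDeriv ℝ n (pressureSource w) (x - z)‖ ≤ S) :
    ‖iteratedFDeriv ℝ n (nearPotential 1 2 w) x‖ ≤ newtonNearMass * S := by
  have hwn : ContDiff ℝ (n + 2 : ℕ) w := contDiff_infty.1 hw (n + 2)
  have hG : ContDiff ℝ n (pressureSource w) := contDiff_pressureSource (by exact_mod_cast hwn)
  have hk : Integrable (newtonNear (1 : ℝ) 2) := integrable_newtonNear zero_le_one one_lt_two
  have hkρ : ∀ z : ℝ³, 2 < ‖z‖ → newtonNear (1 : ℝ) 2 z = 0 := fun z hz => newtonNear_eq_zero zero_le_one one_lt_two hz.le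
  have e0 : nearPotential 1 2 w = fun x => ∫ z, newtonNear (1 : ℝ) 2 z • pressureSource w (x - z) := by
    funext x; simp only [nearPotential, smul_eq_mul]
  have hS0 : 0 ≤ S := (norm_nonneg _).trans (hS 0 (by rw [norm_zero]; norm_num))
  have hN0 : 0 ≤ newtonNearMass := newtonNearMass_nonneg
  refine ContinuousMultilinearMap.opNorm_le_bound (by positivity) fun m => ?_
  rw [e0, iteratedFDeriv_integral_smul_comp_sub_apply hk hkρ n hG x m]
  have hint : Integrable fun z : ℝ³ => |newtonNear (1 : ℝ) 2 z| * (S * ∏ i, ‖m i‖) := hk.abs.mul_const _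
  calc ‖∫ z, newtonNear (1 : ℝ) 2 z • iteratedFDeriv ℝ n (pressureSource w) (x - z) m‖
      ≤ ∫ z, |newtonNear (1 : ℝ) 2 z| * (S * ∏ i, ‖m i‖) := by
        refine norm_integral_le_of_norm_le hint (Eventually.of_forall fun z => ?_)
        rw [norm_smul, Real.norm_eq_abs]
        by_cases hz : ‖z‖ ≤ 2
        · refine mul_le_mul_of_nonneg_left ?_ (abs_nonneg _)
          calc ‖iteratedFDeriv ℝ n (pressureSource w) (x - z) m‖
              ≤ ‖iteratedFDeriv ℝ n (pressureSource w) (x - z)‖ * ∏ i, ‖m i‖ :=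
                ContinuousMultilinearMap.le_opNorm _ _
            _ ≤ S * ∏ i, ‖m i‖ := mul_le_mul_of_nonneg_right (hS z hz) (by positivity)
        · rw [hkρ z (not_le.1 hz), abs_zero, zero_mul, zero_mul]
    _ = newtonNearMass * S * ∏ i, ‖m i‖ := by rw [integral_mul_const]; ring

/-! ### The far potential at all orders -/

/-- **All derivatives of the far potential of a near-singular Type-I profile, at points `‖x‖ ≤ 16`.**  For `v`
continuous in a decay class `‖v(y)‖ ≤ C_d/(1+‖y‖)` (so that `DⁿQ₂[v](x) m = ∫ DⁿΦ(x − y) m (v y, v y) dy`, `Φ = D²Γ∞`,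
`iteratedFDeriv_farPotential_apply`) with the profile bound `‖v(y)‖ ≤ C₀/(‖y‖ + s₀)`, `s₀ > 0`:
`‖DⁿQ₂[v](x)‖ ≤ M K_far C₀²` whenever `‖DⁿΦ(z)‖ ≤ M/(1+|z|)³` (the dominator `exists_dominator_far` for the scalar
kernel `(∏‖mᵢ‖) ‖DⁿΦ‖`, uniformly in `s₀`). [folklore] -/
theorem norm_iteratedFDeriv_farPotential_le (n : ℕ) {M : ℝ}
    (hM : HasDecay 3 M (iteratedFDeriv ℝ n (fderiv ℝ (fderiv ℝ (newtonFar (1 : ℝ) 2)))))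
    {v : ℝ³ → ℝ³} (hvc : Continuous v) {Cd C₀ s₀ : ℝ} (hdec : ∀ y, ‖v y‖ ≤ Cd / (1 + ‖y‖))
    (hs₀ : 0 < s₀) (hv : ∀ y, ‖v y‖ ≤ C₀ / (‖y‖ + s₀)) {x : ℝ³} (hx : ‖x‖ ≤ 16) :
    ‖iteratedFDeriv ℝ n (farPotential 1 2 v) x‖ ≤
      M * (3 * (volume : Measure ℝ³).real (ball 0 1) * 80 + 256 * ∫ y : ℝ³, ((1 + ‖y‖) ^ 5)⁻¹) * C₀ ^ 2 := by
  have hKf0 := farConst_nonneg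
  have hM0 : 0 ≤ M := hM.nonneg
  set Φ := fderiv ℝ (fderiv ℝ (newtonFar (1 : ℝ) 2)) with hΦ
  refine ContinuousMultilinearMap.opNorm_le_bound (by positivity) fun m => ?_
  rw [iteratedFDeriv_farPotential_apply n hvc hdec x m]
  set P : ℝ := ∏ i, ‖m i‖ with hP
  have hP0 : 0 ≤ P := by rw [hP]; positivity
  -- the scalar kernel `Ψ = P ‖DⁿΦ‖`
  set Ψ : ℝ³ → ℝ := fun z => P * ‖iteratedFDeriv ℝ n Φ z‖ with hΨ
  have hΨd : HasDecay 3 (M * P) Ψ := fun z => by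
    show ‖P * ‖iteratedFDeriv ℝ n Φ z‖‖ ≤ M * P * ((1 + ‖z‖) ^ 3)⁻¹
    rw [Real.norm_of_nonneg (by positivity : (0 : ℝ) ≤ P * ‖iteratedFDeriv ℝ n Φ z‖)]
    calc P * ‖iteratedFDeriv ℝ n Φ z‖ ≤ P * (M * ((1 + ‖z‖) ^ 3)⁻¹) := mul_le_mul_of_nonneg_left (hM z) hP0
      _ = M * P * ((1 + ‖z‖) ^ 3)⁻¹ := by ring
  obtain ⟨g, hgi, hae, hgint⟩ := exists_dominator_far hΨd hs₀ hv hx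
  refine (norm_integral_le_of_dominator hgi hae fun y => ?_).trans (hgint.trans (le_of_eq (by ring)))
  show ‖iteratedFDeriv ℝ n Φ (x - y) m (v y) (v y)‖ ≤ ‖P * ‖iteratedFDeriv ℝ n Φ (x - y)‖‖ * ‖v y‖ ^ 2
  rw [Real.norm_of_nonneg (by positivity : (0 : ℝ) ≤ P * ‖iteratedFDeriv ℝ n Φ (x - y)‖)]
  calc ‖iteratedFDeriv ℝ n Φ (x - y) m (v y) (v y)‖
      ≤ ‖iteratedFDeriv ℝ n Φ (x - y) m (v y)‖ * ‖v y‖ := ContinuousLinearMap.le_opNorm _ _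
    _ ≤ ‖iteratedFDeriv ℝ n Φ (x - y) m‖ * ‖v y‖ * ‖v y‖ := by gcongr; exact ContinuousLinearMap.le_opNorm _ _
    _ ≤ ‖iteratedFDeriv ℝ n Φ (x - y)‖ * P * ‖v y‖ * ‖v y‖ := by gcongr; exact ContinuousMultilinearMap.le_opNorm _ _
    _ = P * ‖iteratedFDeriv ℝ n Φ (x - y)‖ * ‖v y‖ ^ 2 := by ring

/-! ### The bounds at the normalised parabolic scale `16`, all orders -/

/-- **The Riesz pressure of a classical Type-I solution at the normalised parabolic scale, order `n`.**  For
every `n` and every Type-I constant `C` there is `K = K(n, C)` such that for every classical solution `(w, q)` of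
Navier–Stokes (`ν = 1`, `f = 0`) on `(−∞, 0)` with `‖w(s,z)‖ ≤ C/(‖z‖ + √(−s))` and every point with
`max{‖y‖, √(−s)} = 16`: `‖DⁿQ[w(s)](y)‖ ≤ K` (`Q = pressurePotential`).  On `B(y, 2)` all points have parabolic
size `≥ 1`, so `‖Dʲw(s)‖ ≤ Kⱼ(C)` there for `j ≤ n + 2` (`PineauVicol2026.exists_forall_iteratedFDeriv_le_of_typeI`),
hence `‖DⁿG[w(s)]‖ ≤ S` (`norm_iteratedFDeriv_pressureSource_le`) and the near part is bounded
(`norm_iteratedFDeriv_nearPotential_le`); the far part is `norm_iteratedFDeriv_farPotential_le` with the kernel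
decay `stub_apexRegKernelDecay`; `Q = −Q₁ − Q₂`. [cite: SereginSverak2009, §2 p. 8] -/
theorem apexRieszPressure_unitScaleBounds_all (n : ℕ) (C : ℝ) :
    ∃ K : ℝ, 0 ≤ K ∧ ∀ (w : ℝ → ℝ³ → ℝ³) (q : ℝ → ℝ³ → ℝ),
      IsClassicalNSSolutionOn (Iio 0) 1 0 w q → HasTypeIDecay C w →
      ∀ s < (0 : ℝ), ∀ y : ℝ³, max ‖y‖ (Real.sqrt (-s)) = 16 →
        ‖iteratedFDeriv ℝ n (pressurePotential (w s)) y‖ ≤ K := by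
  -- constants: velocity derivatives of all orders, the kernel, the far field
  have hKex := fun j : ℕ => PineauVicol2026.exists_forall_iteratedFDeriv_le_of_typeI j C
  choose Kv hKv0 hKv using hKex
  obtain ⟨M, hM⟩ := stub_apexRegKernelDecay n
  have hM0 : 0 ≤ M := hM.nonneg
  set Kf : ℝ := 3 * (volume : Measure ℝ³).real (ball 0 1) * 80 + 256 * ∫ y : ℝ³, ((1 + ‖y‖) ^ 5)⁻¹ with hKf
  have hKf0 : 0 ≤ Kf := farConst_nonneg
  set T : ℝ := ‖(traceCLM : (ℝ³ →L[ℝ] ℝ³) →L[ℝ] ℝ)‖ with hT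
  have hT0 : 0 ≤ T := norm_nonneg _
  set B : ℝ := ∑ j ∈ Finset.range (n + 3), Kv j with hB
  have hB0 : 0 ≤ B := Finset.sum_nonneg fun j _ => hKv0 j
  have hKvB : ∀ j ≤ n + 2, Kv j ≤ B := fun j hj =>
    Finset.single_le_sum (f := Kv) (fun i _ => hKv0 i) (Finset.mem_range.2 (by omega))
  set S : ℝ := T * ((1 + T) * (2 ^ (n + 1) * B ^ 2)) with hS
  have hS0 : 0 ≤ S := by rw [hS]; positivity
  have hN0 : 0 ≤ newtonNearMass := newtonNearMass_nonneg
  refine ⟨newtonNearMass * S + M * Kf * C ^ 2, by positivity, fun w q hsol hdec s hs y hy => ?_⟩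
  -- the slice, its profile and its decay class
  set ws := w s with hws_def
  have hws : ContDiff ℝ ∞ ws := hsol.contDiff_velocity hs
  set σ : ℝ := Real.sqrt (-s) with hσ
  have hσ0 : 0 < σ := Real.sqrt_pos.2 (by linarith)
  have hv : ∀ z, ‖ws z‖ ≤ C / (‖z‖ + σ) := fun z => hdec s hs z
  have hv' : ∀ z, ‖ws z‖ ≤ C / (‖z - 0‖ + σ) := fun z => by rw [sub_zero]; exact hv z
  set Cd : ℝ := C * (1 + ‖(0 : ℝ³)‖ + σ) / min σ 1 with hCd
  have hdecay : ∀ z, ‖ws z‖ ≤ Cd / (1 + ‖z‖) := fun z => PineauVicol2026.decay_of_profile hσ0 hv' z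
  have hy16 : ‖y‖ ≤ 16 := by rw [← hy]; exact le_max_left _ _
  -- derivative bounds on the ball `B(y, 2)`, all orders `j ≤ n + 2`
  have hmax : ∀ z : ℝ³, ‖z‖ ≤ 2 → 1 ≤ max ‖y - z‖ σ := fun z hz => one_le_max_of_normalised hy hz
  have hinv : ∀ z : ℝ³, ‖z‖ ≤ 2 → ∀ j : ℕ, ((max ‖y - z‖ σ)⁻¹) ^ (j + 1) ≤ 1 := fun z hz j =>
    pow_le_one₀ (inv_nonneg.2 (le_trans zero_le_one (hmax z hz))) (inv_le_one_of_one_le₀ (hmax z hz))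
  have hBall : ∀ z : ℝ³, ‖z‖ ≤ 2 → ∀ j ≤ n + 2, ‖iteratedFDeriv ℝ j ws (y - z)‖ ≤ B := by
    intro z hz j hj
    have hs' : s ∈ Iio (0 : ℝ) := hs
    calc ‖iteratedFDeriv ℝ j ws (y - z)‖ ≤ Kv j * ((max ‖y - z‖ σ)⁻¹) ^ (j + 1) :=
          hKv j w q hsol (fun t ht x => hdec t ht x) s hs' (y - z)
      _ ≤ Kv j * 1 := mul_le_mul_of_nonneg_left (hinv z hz j) (hKv0 j)
      _ ≤ B := by rw [mul_one]; exact hKvB j hj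
  -- the source on `B(y, 2)`, the near and the far part
  have hGn : ∀ z : ℝ³, ‖z‖ ≤ 2 → ‖iteratedFDeriv ℝ n (pressureSource ws) (y - z)‖ ≤ S := fun z hz =>
    norm_iteratedFDeriv_pressureSource_le hws n hB0 (y - z) fun j hj => hBall z hz j hj
  have hnear := norm_iteratedFDeriv_nearPotential_le hws n y hGn
  have hfar := norm_iteratedFDeriv_farPotential_le n hM hws.continuous hdecay hσ0 hv hy16
  -- the potential is `-N - F`
  have hNn : ContDiff ℝ n (nearPotential 1 2 ws) :=
    contDiff_nearPotential zero_le_one one_lt_two n (by exact_mod_cast contDiff_infty.1 hws (n + 2))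
  have hFn : ContDiff ℝ n (farPotential 1 2 ws) := contDiff_farPotential_decay_all n hws.continuous hdecay
  have eQ : pressurePotential ws = (-nearPotential 1 2 ws) - farPotential 1 2 ws := by
    funext x; simp only [pressurePotential, Pi.sub_apply, Pi.neg_apply]
  have hNneg : ContDiff ℝ n (-nearPotential 1 2 ws) := hNn.neg
  rw [eQ, iteratedFDeriv_sub_apply hNneg.contDiffAt hFn.contDiffAt, iteratedFDeriv_neg_apply]
  calc ‖-iteratedFDeriv ℝ n (nearPotential 1 2 ws) y - iteratedFDeriv ℝ n (farPotential 1 2 ws) y‖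
      ≤ ‖-iteratedFDeriv ℝ n (nearPotential 1 2 ws) y‖ + ‖iteratedFDeriv ℝ n (farPotential 1 2 ws) y‖ :=
        norm_sub_le _ _
    _ ≤ newtonNearMass * S + M * Kf * C ^ 2 := by rw [norm_neg]; exact add_le_add hnear hfar

/-! ### The scale-invariant bounds in physical variables, all orders -/

/-- **Registered sub-goal `stub_apexRegPressureBounds` of `stub_apexRegularity`: scale-invariant pointwise bounds
for ALL derivatives of the Riesz pressure of a classical Type-I solution on the past.**  For every `n` and `C`
there is `K = K(n, C) ≥ 0` with `(‖x‖+√(−t))^{n+2} ‖DⁿQ[v(t)](x)‖ ≤ K` for all `t < 0`, `x`, and every classical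
solution `(v, q)` of Navier–Stokes (`ν = 1`, `f = 0`) on `(−∞, 0)` with `‖v(t,x)‖ ≤ C/(‖x‖+√(−t))`
(`Q = pressurePotential`).  Proof: `w = nsRescale λ v`, `λ = max{‖x‖, √(−t)}/16`, is a classical Type-I solution with
the SAME `C`, the point becomes `(s, y)` with `max{‖y‖, √(−s)} = 16`, and `Q[v(t)] = λ⁻² Q[w(s)](λ⁻¹ ·)`
(`pressurePotential_zoom`); conclude by `apexRieszPressure_unitScaleBounds_all` and `‖x‖ + √(−t) ≤ 32λ`.
[cite: SereginSverak2009, §2 p. 8] -/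
theorem stub_apexRegPressureBounds :
    ∀ (n : ℕ) (C : ℝ), ∃ K : ℝ, 0 ≤ K ∧ ∀ (v : ℝ → EuclideanSpace ℝ (Fin 3) → EuclideanSpace ℝ (Fin 3))
      (q : ℝ → EuclideanSpace ℝ (Fin 3) → ℝ), IsClassicalNSSolutionOn (Iio (0 : ℝ)) 1 0 v q →
      HasTypeIDecay C v → ∀ t < (0 : ℝ), ∀ x : EuclideanSpace ℝ (Fin 3), (‖x‖ + Real.sqrt (-t)) ^ (n + 2) *
      ‖iteratedFDeriv ℝ n (pressurePotential (v t)) x‖ ≤ K := by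
  intro n C
  obtain ⟨K₀, hK₀0, hK₀⟩ := apexRieszPressure_unitScaleBounds_all n C
  refine ⟨32 ^ (n + 2) * K₀, by positivity, fun v q hsol hdec t ht x => ?_⟩
  -- the scale of the point
  set m : ℝ := max ‖x‖ (Real.sqrt (-t)) with hm
  have hst : 0 < Real.sqrt (-t) := Real.sqrt_pos.2 (by linarith)
  have hm0 : 0 < m := lt_max_of_lt_right hst
  set lam : ℝ := m / 16 with hlam
  have hlam0 : 0 < lam := by rw [hlam]; positivity
  have hlam2 : 0 < lam ^ 2 := by positivity
  -- the rescaled solution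
  set w : ℝ → ℝ³ → ℝ³ := nsRescale lam v with hw
  have hsolw : IsClassicalNSSolutionOn (Iio 0) 1 0 w (nsRescalePressure lam q) := by
    have h := IsClassicalNSSolutionOn.nsRescale_holds hsol hlam0
    rw [Set.preimage_const_mul_Iio₀ (0 : ℝ) hlam2, zero_div, nsRescaleForce_zero] at h
    exact h
  have hdecw : HasTypeIDecay C w := hdec.nsRescale hlam0
  -- the normalised point
  set s : ℝ := t / lam ^ 2 with hs
  set y : ℝ³ := lam⁻¹ • x with hy
  have hs0 : s < 0 := div_neg_of_neg_of_pos ht hlam2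
  have hts : lam ^ 2 * s = t := by rw [hs]; field_simp
  have hys : max ‖y‖ (Real.sqrt (-s)) = 16 := by
    have e1 : ‖y‖ = lam⁻¹ * ‖x‖ := by rw [hy, norm_smul, norm_inv, Real.norm_of_nonneg hlam0.le]
    have e2 : Real.sqrt (-s) = lam⁻¹ * Real.sqrt (-t) := by
      rw [hs, show -(t / lam ^ 2) = -t / lam ^ 2 by ring, Real.sqrt_div' _ hlam2.le,
        Real.sqrt_sq hlam0.le]
      ring
    rw [e1, e2, ← mul_max_of_nonneg _ _ (inv_nonneg.2 hlam0.le), ← hm, hlam]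
    field_simp
  -- the slice identity `v t = λ⁻¹ • w(s, λ⁻¹ ·)`
  have hslice : v t = fun ξ => lam⁻¹ • w s (lam⁻¹ • ξ) := by
    funext ξ
    rw [hw, nsRescale_apply, hts, smul_inv_smul₀ hlam0.ne', smul_smul, inv_mul_cancel₀ hlam0.ne',
      one_smul]
  -- the slice of `w` at `s`: smoothness and decay class
  have hws : ContDiff ℝ ∞ (w s) := hsolw.contDiff_velocity hs0
  have hws2 : ContDiff ℝ 2 (w s) := hws.of_le (by norm_cast)
  have hσ0 : 0 < Real.sqrt (-s) := Real.sqrt_pos.2 (by linarith)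
  have hv' : ∀ z, ‖w s z‖ ≤ C / (‖z - 0‖ + Real.sqrt (-s)) := fun z => by rw [sub_zero]; exact hdecw s hs0 z
  have hWd : ∀ z, ‖w s z‖ ≤ C * (1 + ‖(0 : ℝ³)‖ + Real.sqrt (-s)) / min (Real.sqrt (-s)) 1 / (1 + ‖z‖) :=
    fun z => PineauVicol2026.decay_of_profile hσ0 hv' z
  -- covariance of the pressure potential
  set Q : ℝ³ → ℝ := pressurePotential (w s) with hQ
  have hQn : ContDiff ℝ n Q := contDiff_pressurePotential_decay_all n hws hWd
  set g : ℝ³ → ℝ := lam⁻¹ • Q with hg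
  have hgn : ContDiff ℝ n g := hQn.const_smul lam⁻¹
  have hcov : pressurePotential (v t) = fun ξ => lam⁻¹ • g (lam⁻¹ • (ξ - 0)) := by
    funext ξ
    rw [hslice, pressurePotential_zoom hws2 hWd lam⁻¹ (inv_pos.2 hlam0) ξ, sub_zero]
    simp only [hg, Pi.smul_apply, smul_eq_mul, hQ]
    ring
  -- the unit-scale bound at `(s, y)`
  have hb : ‖iteratedFDeriv ℝ n Q y‖ ≤ K₀ := hK₀ w _ hsolw hdecw s hs0 y hys
  have hy' : lam⁻¹ • (x - 0) = y := by rw [sub_zero]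
  have hgnorm : ‖iteratedFDeriv ℝ n g y‖ = lam⁻¹ * ‖iteratedFDeriv ℝ n Q y‖ := by
    rw [hg, iteratedFDeriv_const_smul_apply hQn.contDiffAt, norm_smul, norm_inv, Real.norm_of_nonneg hlam0.le]
  have hunzoom : ‖iteratedFDeriv ℝ n (pressurePotential (v t)) x‖ ≤
      lam⁻¹ ^ (n + 2) * ‖iteratedFDeriv ℝ n Q y‖ := by
    rw [hcov]
    refine (PineauVicol2026.norm_iteratedFDeriv_unzoom_le hgn hlam0 0 x).trans (le_of_eq ?_)
    rw [hy', hgnorm]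
    ring
  -- the weight `‖x‖ + √(-t) ≤ 32 λ`
  have hR : ‖x‖ + Real.sqrt (-t) ≤ 32 * lam := by
    have h1 : ‖x‖ ≤ m := le_max_left _ _
    have h2 : Real.sqrt (-t) ≤ m := le_max_right _ _
    rw [hlam]; linarith
  have hR0 : 0 ≤ ‖x‖ + Real.sqrt (-t) := by positivity
  have hRn : (‖x‖ + Real.sqrt (-t)) ^ (n + 2) * lam⁻¹ ^ (n + 2) ≤ 32 ^ (n + 2) := by
    calc (‖x‖ + Real.sqrt (-t)) ^ (n + 2) * lam⁻¹ ^ (n + 2) ≤ (32 * lam) ^ (n + 2) * lam⁻¹ ^ (n + 2) :=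
          mul_le_mul_of_nonneg_right (pow_le_pow_left₀ hR0 hR _) (by positivity)
      _ = 32 ^ (n + 2) * (lam * lam⁻¹) ^ (n + 2) := by rw [mul_pow, mul_pow]; ring
      _ = 32 ^ (n + 2) := by rw [mul_inv_cancel₀ hlam0.ne', one_pow, mul_one]
  calc (‖x‖ + Real.sqrt (-t)) ^ (n + 2) * ‖iteratedFDeriv ℝ n (pressurePotential (v t)) x‖
      ≤ (‖x‖ + Real.sqrt (-t)) ^ (n + 2) * (lam⁻¹ ^ (n + 2) * ‖iteratedFDeriv ℝ n Q y‖) :=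
        mul_le_mul_of_nonneg_left hunzoom (by positivity)
    _ = (‖x‖ + Real.sqrt (-t)) ^ (n + 2) * lam⁻¹ ^ (n + 2) * ‖iteratedFDeriv ℝ n Q y‖ := by ring
    _ ≤ 32 ^ (n + 2) * K₀ := mul_le_mul hRn hb (norm_nonneg _) (by positivity)

/-! ### The Riesz pressure of a classical Type-I solution: the whole package -/

section Assembly

open Summit.NavierStokesRegularity.NavierStokesRegularity.Theorems.SymmetricScarExists.LogtimeBernoulli
  (stub_typeITimeDerivDecay contDiffOn_farPotential_zero_of_decay isSmoothSpaceTimeOn_pressurePotential_of_far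
    isClassicalNSSolutionOn_pressurePotential exists_weight_pow_mul_norm_iteratedFDeriv_le)

variable {V : ℝ → ℝ³ → ℝ³} {q : ℝ → ℝ³ → ℝ} {C : ℝ}

/-- **The Riesz pressure of a classical Type-I solution is jointly smooth on the past.**  For a classical
solution `(V, q)` of Navier–Stokes (`ν = 1`, `f = 0`) on `(−∞,0) × ℝ³` with `‖V(t,x)‖ ≤ C/(‖x‖+√(−t))`,
`(t, x) ↦ Q[V(t)](x)` is jointly `C^∞` there: by the sibling crux's reduction (`isSmoothSpaceTimeOn_pressurePotential_of_far`,
`contDiffOn_farPotential_zero_of_decay`) this is the decay at spatial infinity of the iterated TIME derivatives of `V`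
on compact windows, `stub_typeITimeDerivDecay` (KNSS 2009 Prop. 4.1 + Thm. 6.1, Landau–Kolmogorov in time).
[cite: KochNadirashviliSereginSverak2009, Prop. 4.1 and Thm. 6.1 (arXiv:0709.3599 pp. 8, 11–12)] -/
theorem isSmoothSpaceTimeOn_rieszPressure (hsol : IsClassicalNSSolutionOn (Iio 0) 1 0 V q)
    (hdec : HasTypeIDecay C V) :
    IsSmoothSpaceTimeOn (Iio 0) (fun t x => pressurePotential (V t) x) :=
  isSmoothSpaceTimeOn_pressurePotential_of_far hsol hdec
    (contDiffOn_farPotential_zero_of_decay hsol.smooth_velocity (stub_typeITimeDerivDecay V q C hsol hdec))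

/-- **A classical Type-I solution is classical with its Riesz pressure** (the decaying gauge): `∇q = ∇Q[V]`
(`PineauVicol2026.gradient_pressure_eq_of_typeI_vertex`) and `Q[V]` is jointly smooth
(`isSmoothSpaceTimeOn_rieszPressure`). [cite: PineauVicol2026, Lemma 2.1 and Lemma 7.1 (proofs, pp. 9–10 and 23–24)] -/
theorem isClassicalNSSolutionOn_rieszPressure (hsol : IsClassicalNSSolutionOn (Iio 0) 1 0 V q)
    (hdec : HasTypeIDecay C V) :
    IsClassicalNSSolutionOn (Iio 0) 1 0 V (fun t x => pressurePotential (V t) x) :=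
  isClassicalNSSolutionOn_pressurePotential hsol hdec (isSmoothSpaceTimeOn_rieszPressure hsol hdec)

/-- From a weighted bound `R^k ‖a‖ ≤ K` (`R > 0`) to `‖a‖ ≤ L / R^k` for any `L ≥ K`. [folklore] -/
theorem le_div_pow_of_pow_mul_le {R a K L : ℝ} (hR : 0 < R) (k : ℕ) (h : R ^ k * a ≤ K) (hKL : K ≤ L) :
    a ≤ L / R ^ k := by
  rw [le_div_iff₀ (pow_pos hR k), mul_comm]
  exact h.trans hKL

/-- **The all-orders scale-invariant package of `(V, Q[V])`.**  For a classical solution `(V, q)` of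
Navier–Stokes (`ν = 1`, `f = 0`) on `(−∞,0) × ℝ³` with `‖V(t,x)‖ ≤ C/(‖x‖+√(−t))`, the pair `(V, Q[V])` (Riesz
pressure) satisfies `ScaleInvariantBounds`: the velocity at all orders is `exists_weight_pow_mul_norm_iteratedFDeriv_le`
(Seregin–Šverák's quantitative interior regularity, rescaled), the pressure at all orders is
`stub_apexRegPressureBounds`, and `∂ₜDⁿV` is read off the differentiated momentum equation with the pressure
`Q[V]` (`stub_apexRegTimeDerivative`, which needs `Dⁿ⁺¹Q[V]`). [cite: SereginSverak2009, §2 p. 8] -/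
theorem scaleInvariantBounds_rieszPressure (hsol : IsClassicalNSSolutionOn (Iio 0) 1 0 V q)
    (hdec : HasTypeIDecay C V) :
    ScaleInvariantBounds V (fun t x => pressurePotential (V t) x) := by
  have hsolQ := isClassicalNSSolutionOn_rieszPressure hsol hdec
  intro n
  -- constants
  have hKex := fun k : ℕ => exists_weight_pow_mul_norm_iteratedFDeriv_le k C
  choose Kv hKv0 hKv using hKex
  obtain ⟨Kp, -, hKp⟩ := stub_apexRegPressureBounds n C
  obtain ⟨Kp', -, hKp'⟩ := stub_apexRegPressureBounds (n + 1) C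
  have hq' : ∀ t < (0 : ℝ), ∀ x : ℝ³, (‖x‖ + Real.sqrt (-t)) ^ (n + 3) *
      ‖iteratedFDeriv ℝ (n + 1) ((fun t x => pressurePotential (V t) x) t) x‖ ≤ Kp' := fun t ht x => hKp' V _ hsolQ hdec t ht x
  have htime := stub_apexRegTimeDerivative V (fun t x => pressurePotential (V t) x) n Kv Kp' hsolQ
    (fun k _ t ht x => hKv k V _ hsolQ hdec t ht x) hq'
  set Tn : ℝ := 3 * Kv (n + 2) + Kp' + ∑ i ∈ Finset.range (n + 1), (n.choose i : ℝ) * Kv (i + 1) * Kv (n - i)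
    with hTn
  refine ⟨max (Kv n) (max Kp Tn), fun t ht x => ?_⟩
  have hst : 0 < Real.sqrt (-t) := Real.sqrt_pos.2 (by linarith)
  have hR : 0 < ‖x‖ + Real.sqrt (-t) := by positivity
  refine ⟨?_, ?_, ?_⟩
  · rw [add_comm 1 n]
    exact le_div_pow_of_pow_mul_le hR (n + 1) (hKv n V _ hsolQ hdec t ht x) (le_max_left _ _)
  · rw [add_comm 2 n]
    exact le_div_pow_of_pow_mul_le hR (n + 2) (hKp V _ hsolQ hdec t ht x) (le_max_of_le_right (le_max_left _ _))
  · rw [add_comm 3 n]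
    exact le_div_pow_of_pow_mul_le hR (n + 3) (htime t ht x) (le_max_of_le_right (le_max_right _ _))

end Assembly

/-- **Registered stub `stub_apexRegularity` (S-reg) of line `moment-conditioned-rellich`: smooth representatives
of apex Type-I profiles carry a decaying classical pressure with the all-orders scale-invariant package.**  A
Type-I ancient mild field `V` with the apex bound `‖V(t,x)‖ ≤ C/(‖x‖+√(−t))` is a classical Navier–Stokes
solution on the open slab `(−∞,0) × ℝ³` for SOME classical pressure (the window pressures of Fabes–Jones–Rivière,
glued: `exists_isClassicalNSSolutionOn_Iio`), hence (`isClassicalNSSolutionOn_rieszPressure`) for its Riesz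
pressure `Q = RᵢRⱼ(VᵢVⱼ)` — jointly smooth because the time derivatives of `V` decay at spatial infinity
(`stub_typeITimeDerivDecay`) — and `(V, Q)` obeys `ScaleInvariantBounds` (`scaleInvariantBounds_rieszPressure`:
`‖∇ⁿV‖ ≤ L/(‖x‖+√(−t))^{1+n}`, `‖∇ⁿQ‖ ≤ L/(‖x‖+√(−t))^{2+n}`, `‖∂ₜ∇ⁿV‖ ≤ L/(‖x‖+√(−t))^{3+n}`).
[cite: KochNadirashviliSereginSverak2009, Prop. 4.1 and Thm. 6.1 (arXiv:0709.3599 pp. 8, 11–12)] -/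
theorem stub_apexRegularity :
    ∀ (V : ℝ → ℝ³ → ℝ³) (C : ℝ), 0 < C → IsTypeIAncientMild C V → HasTypeIDecay C V →
      ∃ Q : ℝ → ℝ³ → ℝ, IsClassicalNSSolutionOn (Iio (0 : ℝ)) 1 0 V Q ∧ ScaleInvariantBounds V Q := by
  intro V C _ hV hdec
  obtain ⟨q, hsol⟩ := exists_isClassicalNSSolutionOn_Iio hV
  exact ⟨fun t x => pressurePotential (V t) x, isClassicalNSSolutionOn_rieszPressure hsol hdec,
    scaleInvariantBounds_rieszPressure hsol hdec⟩

end Summit.NavierStokesRegularity.NavierStokesRegularity.Theorems.RellichScarScarRigidity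

end
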